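/-
Origin: expansion seat `planner-pub-hodgecm-toy-0`, handover #2 2026-08-18T04:13:45Z (`HOME/pub-hodgecm-toy/lean/Toy/EigenBasis.lean`, md5 ec00ac21, 443 lines);
landed by the gen-5 packager in gate run 21 as `HodgeCM/Model/Toy/EigenBasis.lean` (import ^import Toy\.→import HodgeCM.Model.Toy. ×3).
-/
-- HANDOVER (planner-pub-hodgecm-toy-0, unit pub-hodgecm-toy): WIP module `Toy.EigenBasis`; intended final module
-- `HodgeCM.Model.Toy.EigenBasis` (kind L5, toy model / consistency witness); rename `import Toy.X` ↦ the final prefix.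
/-
Copyright: pub-hodgecm cell (HodgeCMPerL). Consistency-witness layer (part (e), referee A G4).

# The eigenbasis of `ℂ ⊗ L X` and the eigen-monomials of `⋀^k_ℂ (ℂ ⊗ L X)`

For an object `X` of the toy universe: the index set `Idx X = Σ_i Hom(F_i, ℂ)`, the eigenbasis
`eB X ⟨i,τ⟩ = eT X i τ` of `ℂ ⊗ L X`, the eigen-monomials `mono g = eB (g 0) ∧ … ∧ eB (g (k-1))`, the
holomorphy count `cnt g = #{j | g j holomorphic}`, and the spans
`FF k p = ⟨mono g | p ≤ cnt g⟩`, `GG k p = ⟨mono g | cnt g < p⟩`, which are complementary.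
-/
import Mathlib
import Summits.HodgeConjecture.HodgeCM.Model.Toy.BaseChange
import Summits.HodgeConjecture.HodgeCM.Model.Toy.Objects
import Summits.HodgeConjecture.HodgeCM.Model.Toy.CMIdempotent

/-! PORT of `HodgeCM/Model/Toy/EigenBasis.lean` (HodgeCMPerL run 82) — verbatim mechanical port; provenance in the PORT header line. -/

namespace HodgeCM.Toy

open scoped TensorProduct
open exteriorPower Module
open Literature.AlgebraicGeometry.Motives

noncomputable section

namespace Obj

variable (X : Obj)

/-- Index set of the eigenbasis: (atom index, complex embedding of that atom's field). -/
abbrev Idx : Type := Σ i : X.s.toType, ((X.atom i).F →+* ℂ)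

/-- (Ported verbatim from the HodgeCMPerL package; no docstring in the source.) -/
instance : LinearOrder X.Idx := by
  classical
  exact linearOrderOfSTO WellOrderingRel

/-- `Pi.single` of a non-pure tensor through `piRight`. -/
lemma piRight_symm_pi_single (i : X.s.toType) (x : ℂ ⊗[ℚ] (X.atom i).F) :
    (TensorProduct.piRight ℚ ℂ ℂ (fun j : X.s.toType => ((X.atom j).F : Type))).symm (Pi.single i x)
      = (LinearMap.single ℚ (fun j : X.s.toType => ((X.atom j).F : Type)) i).baseChange ℂ x := by
  induction x using TensorProduct.induction_on with
  | zero => rw [Pi.single_zero, LinearEquiv.map_zero, LinearMap.map_zero]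
  | tmul c m => rw [TensorProduct.piRight_symm_single, LinearMap.baseChange_tmul, LinearMap.coe_single]
  | add x y hx hy => rw [Pi.single_add, LinearEquiv.map_add, hx, hy, LinearMap.map_add]

/-- **The eigenbasis** of `ℂ ⊗ L X`. -/
def eB : Basis X.Idx ℂ X.LC :=
  (Pi.basis fun i : X.s.toType => epsBasis (F := (X.atom i).F)).map
    (TensorProduct.piRight ℚ ℂ ℂ (fun j : X.s.toType => ((X.atom j).F : Type))).symm

/-- (Ported verbatim from the HodgeCMPerL package; no docstring in the source.) -/
@[simp] lemma eB_apply (i : X.s.toType) (τ : (X.atom i).F →+* ℂ) :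
    X.eB ⟨i, τ⟩ = X.eT i τ := by
  rw [eB, Module.Basis.map_apply, Pi.basis_apply, epsBasis_apply, piRight_symm_pi_single]
  rfl

/-- (Ported verbatim from the HodgeCMPerL package; no docstring in the source.) -/
lemma eB_apply' (s : X.Idx) : X.eB s = X.eT s.1 s.2 := X.eB_apply s.1 s.2

/-- holomorphic indices -/
def hol (s : X.Idx) : Prop := s.2 ∈ (X.atom s.1).Φ

/-- complex conjugation on indices -/
def bar (s : X.Idx) : X.Idx := ⟨s.1, NumberField.ComplexEmbedding.conjugate s.2⟩

/-- (Ported verbatim from the HodgeCMPerL package; no docstring in the source.) -/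
@[simp] lemma bar_fst (s : X.Idx) : (X.bar s).1 = s.1 := rfl
/-- (Ported verbatim from the HodgeCMPerL package; no docstring in the source.) -/
@[simp] lemma bar_snd (s : X.Idx) : (X.bar s).2 = NumberField.ComplexEmbedding.conjugate s.2 := rfl

/-- (Ported verbatim from the HodgeCMPerL package; no docstring in the source.) -/
@[simp] lemma bar_bar (s : X.Idx) : X.bar (X.bar s) = s := by
  obtain ⟨i, τ⟩ := s
  exact Sigma.ext rfl (heq_of_eq (NumberField.ComplexEmbedding.involutive_conjugate ((X.atom i).F) τ))

/-- (Ported verbatim from the HodgeCMPerL package; no docstring in the source.) -/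
lemma hol_bar_iff (s : X.Idx) : X.hol (X.bar s) ↔ ¬ X.hol s := by
  have h := (X.atom s.1).cm (NumberField.ComplexEmbedding.conjugate s.2)
  rw [NumberField.ComplexEmbedding.involutive_conjugate ((X.atom s.1).F) s.2] at h
  exact h

/-- the set of holomorphic slots of an index map (classical decidability, fixed once) -/
def holSlots {k : ℕ} (g : Fin k → X.Idx) : Finset (Fin k) :=
  @Finset.filter _ (fun j => X.hol (g j)) (fun _ => Classical.propDecidable _) Finset.univ

/-- (Ported verbatim from the HodgeCMPerL package; no docstring in the source.) -/
lemma mem_holSlots {k : ℕ} (g : Fin k → X.Idx) (j : Fin k) : j ∈ X.holSlots g ↔ X.hol (g j) := by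
  simp only [holSlots, Finset.mem_filter, Finset.mem_univ, true_and]

/-- the number of holomorphic entries of an index map -/
def cnt {k : ℕ} (g : Fin k → X.Idx) : ℕ := (X.holSlots g).card

/-- (Ported verbatim from the HodgeCMPerL package; no docstring in the source.) -/
lemma cnt_le {k : ℕ} (g : Fin k → X.Idx) : X.cnt g ≤ k := by
  unfold cnt
  exact (Finset.card_le_univ _).trans (by simp)

/-- (Ported verbatim from the HodgeCMPerL package; no docstring in the source.) -/
lemma cnt_eq_card_filter {k : ℕ} (g : Fin k → X.Idx) [DecidablePred fun j => X.hol (g j)] :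
    X.cnt g = (Finset.univ.filter fun j => X.hol (g j)).card := by
  unfold cnt
  congr 1
  ext j
  rw [mem_holSlots, Finset.mem_filter]
  simp

/-- (Ported verbatim from the HodgeCMPerL package; no docstring in the source.) -/
lemma cnt_bar {k : ℕ} (g : Fin k → X.Idx) : X.cnt (X.bar ∘ g) + X.cnt g = k := by
  classical
  rw [cnt_eq_card_filter, cnt_eq_card_filter]
  have h1 : (Finset.univ.filter fun j => X.hol ((X.bar ∘ g) j))
      = Finset.univ.filter fun j => ¬ X.hol (g j) := by
    ext j
    simp [hol_bar_iff]
  rw [h1, add_comm, Finset.card_filter_add_card_filter_not]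
  simp

/-- (Ported verbatim from the HodgeCMPerL package; no docstring in the source.) -/
lemma cnt_append {k l : ℕ} (g : Fin k → X.Idx) (g' : Fin l → X.Idx) :
    X.cnt (Fin.append g g') = X.cnt g + X.cnt g' := by
  classical
  rw [cnt_eq_card_filter, cnt_eq_card_filter, cnt_eq_card_filter,
    Finset.card_filter, Finset.card_filter, Finset.card_filter, Fin.sum_univ_add]
  simp

/-- **eigen-monomials** `eB (g 0) ∧ … ∧ eB (g (k-1))` -/
def mono (k : ℕ) (g : Fin k → X.Idx) : ⋀[ℂ]^k X.LC := ιMulti ℂ k (fun j => X.eB (g j))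

/-- (Ported verbatim from the HodgeCMPerL package; no docstring in the source.) -/
lemma mono_def (k : ℕ) (g : Fin k → X.Idx) : X.mono k g = ιMulti ℂ k (X.eB ∘ g) := rfl

/-- (Ported verbatim from the HodgeCMPerL package; no docstring in the source.) -/
lemma span_mono_eq_top (k : ℕ) : Submodule.span ℂ (Set.range (X.mono k)) = ⊤ := by
  rw [eq_top_iff, ← ιMulti_family_span_of_span ℂ (X.eB).span_eq, Submodule.span_le]
  rintro _ ⟨s, rfl⟩
  exact Submodule.subset_span ⟨_, rfl⟩

/-- (Ported verbatim from the HodgeCMPerL package; no docstring in the source.) -/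
lemma coe_mono_mul (k l : ℕ) (g : Fin k → X.Idx) (g' : Fin l → X.Idx) :
    (X.mono k g : ExteriorAlgebra ℂ X.LC) * (X.mono l g') = X.mono (k + l) (Fin.append g g') := by
  rw [mono, mono, ← wedge_coe, BC.wedge_ιMulti, mono]
  congr 2
  funext x
  refine Fin.addCases (fun j => ?_) (fun j => ?_) x <;> simp

/-- `FF k p = ⟨mono g | p ≤ cnt g⟩` (the Hodge filtration on the `A`-side). -/
def FF (k : ℕ) (p : ℤ) : Submodule ℂ (⋀[ℂ]^k X.LC) :=
  Submodule.span ℂ {x | ∃ g : Fin k → X.Idx, p ≤ (X.cnt g : ℤ) ∧ x = X.mono k g}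

/-- `GG k p = ⟨mono g | cnt g < p⟩` (its conjugate complement). -/
def GG (k : ℕ) (p : ℤ) : Submodule ℂ (⋀[ℂ]^k X.LC) :=
  Submodule.span ℂ {x | ∃ g : Fin k → X.Idx, (X.cnt g : ℤ) < p ∧ x = X.mono k g}

/-- (Ported verbatim from the HodgeCMPerL package; no docstring in the source.) -/
lemma mono_mem_FF {k : ℕ} {p : ℤ} {g : Fin k → X.Idx} (h : p ≤ (X.cnt g : ℤ)) : X.mono k g ∈ X.FF k p :=
  Submodule.subset_span ⟨g, h, rfl⟩

/-- (Ported verbatim from the HodgeCMPerL package; no docstring in the source.) -/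
lemma mono_mem_GG {k : ℕ} {p : ℤ} {g : Fin k → X.Idx} (h : (X.cnt g : ℤ) < p) : X.mono k g ∈ X.GG k p :=
  Submodule.subset_span ⟨g, h, rfl⟩

/-- (Ported verbatim from the HodgeCMPerL package; no docstring in the source.) -/
lemma FF_antitone (k : ℕ) : Antitone (X.FF k) := by
  intro p q hpq
  apply Submodule.span_mono
  rintro _ ⟨g, hg, rfl⟩
  exact ⟨g, hpq.trans hg, rfl⟩

/-- (Ported verbatim from the HodgeCMPerL package; no docstring in the source.) -/
lemma FF_eq_top {k : ℕ} {p : ℤ} (hp : p ≤ 0) : X.FF k p = ⊤ := by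
  rw [eq_top_iff, ← span_mono_eq_top, Submodule.span_le]
  rintro _ ⟨g, rfl⟩
  exact X.mono_mem_FF (hp.trans (by positivity))

/-- (Ported verbatim from the HodgeCMPerL package; no docstring in the source.) -/
lemma FF_eq_bot {k : ℕ} {p : ℤ} (hp : (k : ℤ) < p) : X.FF k p = ⊥ := by
  rw [FF, Submodule.span_eq_bot]
  rintro _ ⟨g, hg, rfl⟩
  exfalso
  have := X.cnt_le g
  omega

/-- (Ported verbatim from the HodgeCMPerL package; no docstring in the source.) -/
lemma GG_eq_bot {k : ℕ} {p : ℤ} (hp : p ≤ 0) : X.GG k p = ⊥ := by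
  rw [GG, Submodule.span_eq_bot]
  rintro _ ⟨g, hg, rfl⟩
  exfalso
  omega

/-- (Ported verbatim from the HodgeCMPerL package; no docstring in the source.) -/
lemma FF_sup_GG (k : ℕ) (p : ℤ) : X.FF k p ⊔ X.GG k p = ⊤ := by
  rw [eq_top_iff, ← span_mono_eq_top, Submodule.span_le]
  rintro _ ⟨g, rfl⟩
  by_cases h : p ≤ (X.cnt g : ℤ)
  · exact Submodule.mem_sup_left (X.mono_mem_FF h)
  · exact Submodule.mem_sup_right (X.mono_mem_GG (lt_of_not_ge h))

/-! ### The filtration lemma -/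

/-- `F¹ X` is the span of the holomorphic eigenbasis vectors. -/
lemma F1_eq_span : X.F1 = Submodule.span ℂ (X.eB '' {s | X.hol s}) := by
  unfold F1
  congr 1
  ext x
  constructor
  · rintro ⟨i, τ, hτ, rfl⟩
    exact ⟨⟨i, τ⟩, hτ, X.eB_apply i τ⟩
  · rintro ⟨⟨i, τ⟩, hτ, rfl⟩
    exact ⟨i, τ, hτ, X.eB_apply i τ⟩

/-- (Ported verbatim from the HodgeCMPerL package; no docstring in the source.) -/
lemma eB_mem_F1 {s : X.Idx} (hs : X.hol s) : X.eB s ∈ X.F1 := by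
  rw [F1_eq_span]
  exact Submodule.subset_span ⟨s, hs, rfl⟩

/-- (Ported verbatim from the HodgeCMPerL package; no docstring in the source.) -/
lemma repr_eq_zero_of_mem_F1 {x : X.LC} (hx : x ∈ X.F1) {s : X.Idx} (hs : ¬ X.hol s) :
    X.eB.repr x s = 0 := by
  rw [F1_eq_span] at hx
  have h := X.eB.repr_support_subset_of_mem_span _ hx
  by_contra hne
  exact hs (h (Finsupp.mem_support_iff.mpr hne))

/-- **Filtration lemma**: a wedge of `k` vectors, at least `p` of which are holomorphic, lies in
`FF k p`. -/
theorem ιMulti_mem_FF {k : ℕ} (w : Fin k → X.LC) (p : ℤ) (H : Finset (Fin k))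
    (hH : ∀ j ∈ H, w j ∈ X.F1) (hp : p ≤ H.card) : ιMulti ℂ k w ∈ X.FF k p := by
  classical
  have hw : w = fun j => ∑ s, (X.eB.repr (w j) s) • X.eB s := by
    funext j
    exact (X.eB.sum_repr (w j)).symm
  have hsum := MultilinearMap.map_sum (ιMulti ℂ k (M := X.LC)).toMultilinearMap
    (fun j s => (X.eB.repr (w j) s) • X.eB s)
  simp only [AlternatingMap.coe_multilinearMap] at hsum
  rw [hw, hsum]
  refine Submodule.sum_mem _ fun r _ => ?_
  rw [AlternatingMap.map_smul_univ]
  by_cases hc : (∏ j, X.eB.repr (w j) (r j)) = 0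
  · rw [hc, zero_smul]
    exact zero_mem _
  · refine Submodule.smul_mem _ _ (X.mono_mem_FF ?_)
    have hc := Finset.prod_ne_zero_iff.mp hc
    have hsub : H ⊆ X.holSlots r := by
      intro j hj
      rw [mem_holSlots]
      by_contra hn
      exact hc j (Finset.mem_univ j) (X.repr_eq_zero_of_mem_F1 (hH j hj) hn)
    exact hp.trans (by exact_mod_cast Finset.card_le_card hsub)

/-! ### Eigen-monomials versus the wedge basis -/

/-- (Ported verbatim from the HodgeCMPerL package; no docstring in the source.) -/
lemma mono_eq_zero_of_not_injective {k : ℕ} {g : Fin k → X.Idx} (hg : ¬ Function.Injective g) :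
    X.mono k g = 0 :=
  AlternatingMap.map_eq_zero_of_not_injective _ _
    (by rwa [show (fun j => X.eB (g j)) = X.eB ∘ g from rfl,
      Function.Injective.of_comp_iff X.eB.injective])

/-- the image of an injective index map, as a `k`-subset -/
def imFin {k : ℕ} (g : Fin k → X.Idx) (hg : Function.Injective g) : Set.powersetCard X.Idx k :=
  ⟨Finset.univ.image g, by
    show (Finset.univ.image g).card = k
    rw [Finset.card_image_of_injective _ hg]
    simp⟩

/-- (Ported verbatim from the HodgeCMPerL package; no docstring in the source.) -/
@[simp] lemma imFin_val {k : ℕ} (g : Fin k → X.Idx) (hg : Function.Injective g) :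
    (X.imFin g hg).val = Finset.univ.image g := rfl

/-- holomorphic elements of a finset of indices -/
def nhol (S : Finset X.Idx) : ℕ := (@Finset.filter _ X.hol (fun _ => Classical.propDecidable _) S).card

/-- (Ported verbatim from the HodgeCMPerL package; no docstring in the source.) -/
lemma nhol_image {k : ℕ} (g : Fin k → X.Idx) (hg : Function.Injective g) :
    X.nhol (Finset.univ.image g) = X.cnt g := by
  classical
  rw [cnt_eq_card_filter, ← Finset.card_image_of_injective (Finset.univ.filter fun j => X.hol (g j)) hg]
  unfold nhol
  congr 1
  ext s
  simp only [Finset.mem_filter, Finset.mem_image, Finset.mem_univ, true_and]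
  constructor
  · rintro ⟨⟨j, rfl⟩, h⟩; exact ⟨j, h, rfl⟩
  · rintro ⟨j, h, rfl⟩; exact ⟨⟨j, rfl⟩, h⟩

/-- **± lemma**: an injective eigen-monomial is `±` a member of the wedge basis. -/
lemma mono_eq_sign_smul_basis {k : ℕ} (g : Fin k → X.Idx) (hg : Function.Injective g) :
    ∃ σ : Equiv.Perm (Fin k),
      X.mono k g = Equiv.Perm.sign σ • (X.eB.exteriorPower k) (X.imFin g hg) := by
  classical
  let S := X.imFin g hg
  let e : Fin k ↪o X.Idx := Set.powersetCard.ofFinEmbEquiv.symm S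
  have hrange : Set.range g = Set.range e := by
    ext i
    rw [Set.powersetCard.mem_range_ofFinEmbEquiv_symm_iff_mem, ← Set.powersetCard.mem_coe_iff]
    simp [S]
  let σ : Equiv.Perm (Fin k) :=
    (Equiv.ofInjective g hg).trans ((Equiv.setCongr hrange).trans (Equiv.ofInjective e e.injective).symm)
  have hσ : ∀ j, e (σ j) = g j := fun j => Equiv.apply_ofInjective_symm e.injective _
  refine ⟨σ, ?_⟩
  rw [exteriorPower.basis_apply, ιMulti_family, mono_def,
    show X.eB ∘ g = (X.eB ∘ e) ∘ σ from by funext j; simp [hσ]]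
  exact AlternatingMap.map_perm _ _ σ

/-- (Ported verbatim from the HodgeCMPerL package; no docstring in the source.) -/
lemma zsmul_units_mem {M : Type*} [AddCommGroup M] [Module ℂ M] (W : Submodule ℂ M) (u : ℤˣ) {x : M}
    (hx : x ∈ W) : u • x ∈ W := by
  rw [Units.smul_def]
  exact zsmul_mem hx _

/-- (Ported verbatim from the HodgeCMPerL package; no docstring in the source.) -/
lemma FF_le_span (k : ℕ) (p : ℤ) :
    X.FF k p ≤ Submodule.span ℂ ((X.eB.exteriorPower k) '' {S | p ≤ (X.nhol S.val : ℤ)}) := by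
  rw [FF, Submodule.span_le]
  rintro _ ⟨g, hg, rfl⟩
  by_cases hinj : Function.Injective g
  · obtain ⟨σ, hσ⟩ := X.mono_eq_sign_smul_basis g hinj
    rw [hσ]
    refine zsmul_units_mem _ _ (Submodule.subset_span ⟨X.imFin g hinj, ?_, rfl⟩)
    show p ≤ (X.nhol (Finset.univ.image g) : ℤ)
    rwa [nhol_image _ _ hinj]
  · rw [X.mono_eq_zero_of_not_injective hinj]
    exact zero_mem _

/-- (Ported verbatim from the HodgeCMPerL package; no docstring in the source.) -/
lemma GG_le_span (k : ℕ) (p : ℤ) :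
    X.GG k p ≤ Submodule.span ℂ ((X.eB.exteriorPower k) '' {S | (X.nhol S.val : ℤ) < p}) := by
  rw [GG, Submodule.span_le]
  rintro _ ⟨g, hg, rfl⟩
  by_cases hinj : Function.Injective g
  · obtain ⟨σ, hσ⟩ := X.mono_eq_sign_smul_basis g hinj
    rw [hσ]
    refine zsmul_units_mem _ _ (Submodule.subset_span ⟨X.imFin g hinj, ?_, rfl⟩)
    show (X.nhol (Finset.univ.image g) : ℤ) < p
    rwa [nhol_image _ _ hinj]
  · rw [X.mono_eq_zero_of_not_injective hinj]
    exact zero_mem _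

/-- (Ported verbatim from the HodgeCMPerL package; no docstring in the source.) -/
lemma disjoint_FF_GG (k : ℕ) (p : ℤ) : Disjoint (X.FF k p) (X.GG k p) := by
  refine Disjoint.mono (X.FF_le_span k p) (X.GG_le_span k p) ?_
  apply (X.eB.exteriorPower k).linearIndependent.disjoint_span_image
  rw [Set.disjoint_iff]
  rintro S ⟨h1, h2⟩
  simp only [Set.mem_setOf_eq] at h1 h2
  omega

/-- **`FF k p` and `GG k p` are complementary.** -/
theorem isCompl_FF_GG (k : ℕ) (p : ℤ) : IsCompl (X.FF k p) (X.GG k p) :=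
  ⟨X.disjoint_FF_GG k p, codisjoint_iff.mpr (X.FF_sup_GG k p)⟩

/-! ### Transport along `Θ` and complex conjugation -/

/-- `Θ_X,k : ℂ ⊗ ⋀^k_ℚ L X ≃ ⋀^k_ℂ (ℂ ⊗ L X)` -/
abbrev Θ (k : ℕ) : ℂ ⊗[ℚ] (⋀[ℚ]^k X.L) ≃ₗ[ℂ] ⋀[ℂ]^k X.LC := BC.thetaEquiv ℚ ℂ X.L k

/-- coefficient of the eigenvector `eB s` on the `m`-th rational basis vector of its atom -/
def coef (s : X.Idx) (m : Fin (Module.finrank ℚ (X.atom s.1).F)) : ℂ := s.2 (dF (X.atom s.1).F m)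

/-- the `m`-th rational basis vector of the atom of `s`, placed in slot `s.1` -/
def vec (s : X.Idx) (m : Fin (Module.finrank ℚ (X.atom s.1).F)) : X.L := Pi.single s.1 (bF (X.atom s.1).F m)

/-- (Ported verbatim from the HodgeCMPerL package; no docstring in the source.) -/
lemma eB_expand (s : X.Idx) : X.eB s = ∑ m, X.coef s m • ((1 : ℂ) ⊗ₜ[ℚ] X.vec s m) := by
  rw [eB_apply', eT, eps, map_sum]
  refine Finset.sum_congr rfl fun m _ => ?_
  rw [LinearMap.baseChange_tmul, LinearMap.coe_single, TensorProduct.smul_tmul', smul_eq_mul, mul_one]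
  rfl

/-- **Explicit formula** for `Θ⁻¹` of an eigen-monomial as a rational expansion. -/
lemma theta_symm_mono (k : ℕ) (g : Fin k → X.Idx) :
    (X.Θ k).symm (X.mono k g)
      = ∑ M : (∀ j : Fin k, Fin (Module.finrank ℚ (X.atom (g j).1).F)),
          (∏ j, X.coef (g j) (M j)) ⊗ₜ[ℚ] ιMulti ℚ k (fun j => X.vec (g j) (M j)) := by
  classical
  rw [LinearEquiv.symm_apply_eq, map_sum]
  simp only [BC.thetaEquiv_apply, BC.theta_tmul_ιMulti]
  have hsum := MultilinearMap.map_sum (ιMulti ℂ k (M := X.LC)).toMultilinearMap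
    (fun j m => X.coef (g j) m • ((1 : ℂ) ⊗ₜ[ℚ] X.vec (g j) m))
  simp only [AlternatingMap.coe_multilinearMap] at hsum
  rw [mono, show (fun j => X.eB (g j)) = fun j => ∑ m, X.coef (g j) m • ((1 : ℂ) ⊗ₜ[ℚ] X.vec (g j) m)
    from funext fun j => X.eB_expand (g j), hsum]
  refine Finset.sum_congr rfl fun M _ => ?_
  rw [AlternatingMap.map_smul_univ]


-- port_pkg: scope closed for this part
end Obj
end
end HodgeCM.Toy
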